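import Literature.NumberTheory.GaloisRepresentations.GalLayerSystemIdele
import Literature.NumberTheory.GaloisRepresentations.GaloisSubgroups
import Literature.NumberTheory.IwasawaTheory.Greenberg2006.GaloisCohomologyStructure
import HarnessLib

/-!
# The finite layers of an open subgroup `U = Gal(K_S/F₀) ≤ G_{K,S}`: the open normal subgroups
# `Gal(K_S/E) ≤ U` for the finite Galois `E/K` with `F₀ ⊆ E ⊆ K_S` are COFINAL, and
# `U ⧸ Gal(K_S/E) ≃* Gal(E/F₀)` (Neukirch–Schmidt–Wingberg VIII §3: `G_S(F₀) = Gal(k_S/F₀)`,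
# `Hʳ(G_S(F₀), A) = lim→_E Hʳ(Gal(E/F₀), A^{Gal(k_S/E)})`)

Topic `NumberTheory/GaloisRepresentations`; namespace
`Literature.NumberTheory.GaloisRepresentations.OpenSubgroupLayer`.  Definitions with bodies (group-theoretic
plumbing: a restriction homomorphism, an open normal subgroup, a group isomorphism, an inclusion algebra) and
theorems; NO named fact, no `sorry`, no instance, no notation.

SETTING.  `K` a number field, `S` a set of finite places, `N_S = ramificationSubgroup K S` (`K_S = K̄^{N_S}`,
`G_{K,S} = Γ_K ⧸ N_S`), `H ≤ Γ_K` an OPEN subgroup containing `N_S`, `U := galoisGroupAbove S H = H/N_S ≤ G_{K,S}`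
(the tree's, `Greenberg2006/GaloisCohomologyStructure`) — every open subgroup of `G_{K,S}` is of this form —, and
`F₀ := K̄^H` (`baseField H`, a finite extension of `K` inside `K_S`, NOT necessarily Galois over `K`).  A LAYER of
`U` is a finite Galois `E/K` inside `K̄` (`IdeleClassBar.GalLayer K`) with `F₀ ≤ E` and `N_S ≤ Gal(K̄/E)`
(`galFixing K E`, i.e. `E ⊆ K_S`).  For such `E`:

* §1 `toAbove S H : H →* ↥U` (`σ ↦ σ N_S`; surjective, kernel `N_S`);
* §2 `algOfLE` (the inclusion algebra `F₀ → E`), `galRestrict E hF : H →* (E ≃ₐ[F₀] E)` (`σ ↦ σ|_E`, an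
  `F₀`-automorphism since `σ` fixes `F₀ = K̄^H`; SURJECTIVE because `H` is closed: `Gal(K̄/K̄^H) = H`), its kernel
  `= Gal(K̄/E) ⊓ H`;
* §3 **`layerHom E hF hS : ↥U →* (E ≃ₐ[F₀] E)`** (the factorisation through `H ↠ U`, `N_S` acting trivially on
  `E ⊆ K_S`), surjective; **`layerSubgroup E hF hS hHo : OpenNormalSubgroup ↥U`** (its kernel `= Gal(K_S/E)`, open)
  and **`layerEquiv : ↥U ⧸ layerSubgroup ≃* (E ≃ₐ[F₀] E)`** (`QuotientGroup.quotientKerEquivOfSurjective`), with the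
  formula `layerEquiv [σ N_S] x = σ • x`;
* §4 **COFINALITY `exists_layerSubgroup_le`**: every open normal `W ≤ ↥U` contains some `layerSubgroup E` (the preimage
  of `W` in `Γ_K` contains an open normal `N`; `E := K̄^{N·N_S}`);
* §5 TRANSITIONS: for layers `E ≤ E′`, `layerSubgroup E′ ≤ layerSubgroup E`, and the values formula relating
  `layerEquiv E [u]` and `layerEquiv E′ [u]`.

This is the group-theoretic half of the dictionary between door-c4's abstract layer system
`(OpenNormalSubgroup ↥U, Hⁿ(↥U ⧸ V, M^V))` (`Algebra/Homology/DiscreteRepLayerColimit*`) for an open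
`U ≤ G_{K,S}` and the arithmetic layers `Hⁿ(Gal(E/F₀), 𝒪_{E,S}ˣ)` of NSW (8.3.11)/(8.3.18) — lane «PT3-TC» of cell
`bsd-eis` (crux `GoodLatticeBDPValue`, stmt-BirchSwinnertonDyer-19032; road memo `PT3TC-ROAD.md`, brick (A2-β1));
it generalises door-c4's `IdeleClassBar.galEquivSubgroupImage` (`Gal(E/L) ≃* H_E` for a GALOIS `L`) to an arbitrary
finite `F₀/K` and to the quotient `G_{K,S}` of `Γ_K`.

## References
* J. Neukirch, A. Schmidt, K. Wingberg, *Cohomology of Number Fields*, 2nd ed. (2008), VIII §3 (`G_S(K)` for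
  `K|k` inside `k_S`), (1.5.1), proof of (8.3.18). [NeukirchSchmidtWingberg2008]
* J.-P. Serre, *Cohomologie galoisienne* (1994), I §2.2 Prop. 8. [SerreGaloisCohomology1997]
* J. Neukirch, *Algebraic Number Theory* (1999), Ch. IV §1 (infinite Galois theory). [NeukirchANT1999]
-/

noncomputable section

open NumberField IsDedekindDomain Field Topology
open Literature.NumberTheory.GaloisRepresentations.IdeleClassBar (GalLayer)
open Literature.NumberTheory.GaloisRepresentations.LocalWeilDatum (galFixing mem_galFixing_iff isOpen_galFixing
  isClosed_galFixing galFixing_antitone)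
open Literature.NumberTheory.IwasawaTheory.Greenberg2006 (galoisGroupAbove mem_galoisGroupAbove_iff)

namespace Literature.NumberTheory.GaloisRepresentations

namespace OpenSubgroupLayer

variable {K : Type} [Field K] (S : Set (HeightOneSpectrum (𝓞 K))) (H : Subgroup (absoluteGaloisGroup K))

/-! ### §1. `H ↠ U = H/N_S ≤ G_{K,S}` -/

/-- **`σ ↦ σ N_S : H → U = galoisGroupAbove S H`** (Mathlib `MonoidHom.subgroupMap` of the projection
`Γ_K → G_{K,S}`). [cite: NeukirchSchmidtWingberg2008, VIII §3] -/
def toAbove : H →* ↥(galoisGroupAbove S H) :=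
  (toUnramifiedQuot K S).subgroupMap H

/-- Formula: `toAbove σ = σ N_S`. [cite: NeukirchSchmidtWingberg2008, VIII §3] -/
@[simp] theorem coe_toAbove (σ : H) :
    ((toAbove S H σ : ↥(galoisGroupAbove S H)) : GaloisGroupUnramifiedOutside K S) =
      toUnramifiedQuot K S (σ : absoluteGaloisGroup K) := rfl

/-- `H → H/N_S` is onto. [cite: NeukirchSchmidtWingberg2008, VIII §3] -/
theorem toAbove_surjective : Function.Surjective (toAbove S H) :=
  (toUnramifiedQuot K S).subgroupMap_surjective H

/-- Kernel of `H → H/N_S`: the elements of `H` lying in `N_S`. [cite: NeukirchSchmidtWingberg2008, VIII §3] -/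
theorem mem_ker_toAbove_iff (σ : H) :
    σ ∈ (toAbove S H).ker ↔ (σ : absoluteGaloisGroup K) ∈ ramificationSubgroup K S := by
  rw [MonoidHom.mem_ker, ← Subtype.coe_inj, coe_toAbove, OneMemClass.coe_one]
  exact QuotientGroup.eq_one_iff _

/-- `toAbove` is continuous (the projection `Γ_K → G_{K,S}` is). [cite: NeukirchSchmidtWingberg2008, VIII §3] -/
theorem continuous_toAbove : Continuous (toAbove S H) :=
  Continuous.subtype_mk ((continuous_toUnramifiedQuot K S).comp continuous_subtype_val) _

/-! ### §2. The base field `F₀ = K̄^H` and the restrictions `σ ↦ σ|_E` over `F₀` -/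

/-- **`F₀ = K̄^H`**, the subfield fixed by `H` (for `H` open: a finite extension of `K`; `U = Gal(K_S/F₀)`).
[cite: NeukirchANT1999, Ch. IV §1] -/
abbrev baseField : IntermediateField K (AlgebraicClosure K) :=
  IntermediateField.fixedField (H : Subgroup (AlgebraicClosure K ≃ₐ[K] AlgebraicClosure K))

/-- Elements of `H` fix `F₀` pointwise. [cite: NeukirchANT1999, Ch. IV §1] -/
theorem smul_eq_self_of_mem_baseField {σ : absoluteGaloisGroup K} (hσ : σ ∈ H) {x : AlgebraicClosure K}
    (hx : x ∈ baseField H) : σ • x = x :=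
  (IntermediateField.mem_fixedField_iff (H : Subgroup (AlgebraicClosure K ≃ₐ[K] AlgebraicClosure K)) x).1 hx σ hσ

/-- **For `H` CLOSED, an automorphism fixing `F₀ = K̄^H` pointwise lies in `H`** (`Gal(K̄/K̄^H) = H`, infinite
Galois theory). [cite: NeukirchANT1999, Ch. IV (1.2)] -/
theorem mem_of_forall_smul_eq_self [NumberField K] (hH : IsClosed (H : Set (absoluteGaloisGroup K)))
    {σ : absoluteGaloisGroup K} (h : ∀ x ∈ baseField H, σ • x = x) : σ ∈ H := by
  have h1 : (absoluteGaloisGroup.toAlgEquiv K σ) ∈ (baseField H).fixingSubgroup :=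
    (IntermediateField.mem_fixingSubgroup_iff _ _).2 fun x hx => h x hx
  rw [InfiniteGalois.fixingSubgroup_fixedField
    ⟨(H : Subgroup (AlgebraicClosure K ≃ₐ[K] AlgebraicClosure K)), hH⟩] at h1
  exact h1

/-- The inclusion algebra `F₀ → E` for intermediate fields `F₀ ≤ E` of `K̄/K` (used through `letI`; agrees with
door-c5's `GalLayer.algebraOfLE` when both are layers). [cite: NeukirchANT1999, Ch. IV §1] -/
@[reducible] def algOfLE {F₀ E : IntermediateField K (AlgebraicClosure K)} (h : F₀ ≤ E) : Algebra F₀ E :=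
  (IntermediateField.inclusion h).toRingHom.toAlgebra

/-- `K ⊆ F₀ ⊆ E` is a scalar tower for `algOfLE`. [cite: NeukirchANT1999, Ch. IV §1] -/
theorem isScalarTower_algOfLE {F₀ E : IntermediateField K (AlgebraicClosure K)} (h : F₀ ≤ E) :
    letI := algOfLE h
    IsScalarTower K F₀ E :=
  letI := algOfLE h
  IsScalarTower.of_algebraMap_eq fun _ => rfl

variable {H}

/-- **`σ ↦ σ|_E : H → Gal(E/F₀)`** for a finite Galois `E/K` containing `F₀ = K̄^H`: the restriction `σ|_E`
(door-c5's `GalLayer.restrictHom`) is `F₀`-linear because `σ ∈ H` fixes `F₀`.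
[cite: NeukirchSchmidtWingberg2008, VIII §3] [cite: NeukirchANT1999, Ch. IV §1] -/
def galRestrict (E : GalLayer K) (hF : baseField H ≤ E.1) :
    letI := algOfLE hF
    H →* (E.1 ≃ₐ[baseField H] E.1) :=
  letI := algOfLE hF
  { toFun := fun σ => AlgEquiv.ofRingEquiv (f := (E.restrictHom (σ : absoluteGaloisGroup K)).toRingEquiv)
      fun x => Subtype.ext (by
        change ((E.restrictHom (σ : absoluteGaloisGroup K) ⟨(x : AlgebraicClosure K), hF x.2⟩ : E.1) :
            AlgebraicClosure K) = (x : AlgebraicClosure K)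
        rw [IdeleClassBar.GalLayer.coe_restrictHom_apply]
        exact smul_eq_self_of_mem_baseField H σ.2 x.2)
    map_one' := by ext x; simp
    map_mul' := fun σ τ => by ext x; simp }

/-- Formula on `K̄`-values: `galRestrict σ x = σ • x`. [cite: NeukirchSchmidtWingberg2008, VIII §3] -/
theorem coe_galRestrict_apply (E : GalLayer K) (hF : baseField H ≤ E.1) (σ : H) (x : E.1) :
    letI := algOfLE hF
    ((galRestrict E hF σ x : E.1) : AlgebraicClosure K) = (σ : absoluteGaloisGroup K) • (x : AlgebraicClosure K) :=
  IdeleClassBar.GalLayer.coe_restrictHom_apply E (σ : absoluteGaloisGroup K) x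

/-- Kernel of `σ ↦ σ|_E` on `H`: `Gal(K̄/E) ⊓ H`. [cite: NeukirchANT1999, Ch. IV §1] -/
theorem mem_ker_galRestrict_iff (E : GalLayer K) (hF : baseField H ≤ E.1) (σ : H) :
    letI := algOfLE hF
    σ ∈ (galRestrict E hF).ker ↔ (σ : absoluteGaloisGroup K) ∈ galFixing K E.1 := by
  letI := algOfLE hF
  rw [MonoidHom.mem_ker, mem_galFixing_iff]
  constructor
  · intro h x hx
    have h1 := congrArg (fun τ : E.1 ≃ₐ[baseField H] E.1 => ((τ ⟨x, hx⟩ : E.1) : AlgebraicClosure K)) h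
    simp only [AlgEquiv.one_apply] at h1
    rw [coe_galRestrict_apply] at h1
    exact h1
  · intro h
    ext x
    exact (coe_galRestrict_apply E hF σ x).trans (h x x.2)

/-- **`σ ↦ σ|_E : H → Gal(E/F₀)` is onto for `H` closed**: an `F₀`-automorphism `τ` of `E` extends to `σ ∈ Γ_K`
(`restrictHom_surjective`), which fixes `F₀ ⊆ E` pointwise, hence lies in `H = Gal(K̄/K̄^H)`.
[cite: NeukirchANT1999, Ch. IV (1.2)] -/
theorem galRestrict_surjective [NumberField K] (hH : IsClosed (H : Set (absoluteGaloisGroup K))) (E : GalLayer K)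
    (hF : baseField H ≤ E.1) :
    letI := algOfLE hF
    Function.Surjective (galRestrict E hF) := by
  letI := algOfLE hF
  haveI := isScalarTower_algOfLE (K := K) hF
  intro τ
  obtain ⟨σ, hσ⟩ := E.restrictHom_surjective (τ.restrictScalars K)
  have hσH : σ ∈ H := by
    refine mem_of_forall_smul_eq_self H hH fun x hx => ?_
    have h1 : ((E.restrictHom σ ⟨x, hF hx⟩ : E.1) : AlgebraicClosure K) = σ • x :=
      IdeleClassBar.GalLayer.coe_restrictHom_apply E σ ⟨x, hF hx⟩
    rw [← h1, hσ]
    change ((τ (algebraMap (baseField H) E.1 ⟨x, hx⟩) : E.1) : AlgebraicClosure K) = x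
    rw [AlgEquiv.commutes]
    rfl
  refine ⟨⟨σ, hσH⟩, ?_⟩
  apply AlgEquiv.ext
  intro x
  exact congrArg (fun f : E.1 ≃ₐ[K] E.1 => f x) hσ

/-! ### §3. The layer homomorphism `U → Gal(E/F₀)`, the layer subgroup and `U ⧸ Gal(K_S/E) ≃* Gal(E/F₀)` -/

/-- `N_S` acts trivially on `E ⊆ K_S`: the kernel of `H ↠ U` lies in the kernel of `σ ↦ σ|_E`.
[cite: NeukirchSchmidtWingberg2008, VIII §3] -/
theorem ker_toAbove_le_ker_galRestrict (E : GalLayer K) (hF : baseField H ≤ E.1)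
    (hS : ramificationSubgroup K S ≤ galFixing K E.1) :
    letI := algOfLE hF
    (toAbove S H).ker ≤ (galRestrict E hF).ker := fun σ hσ => by
  rw [mem_ker_galRestrict_iff]
  exact hS ((mem_ker_toAbove_iff S H σ).1 hσ)

/-- **`layerHom : U → Gal(E/F₀)`**, `σ N_S ↦ σ|_E` (the factorisation of `galRestrict` through `H ↠ U = H/N_S`,
Mathlib `MonoidHom.liftOfSurjective`). [cite: NeukirchSchmidtWingberg2008, VIII §3] -/
def layerHom (E : GalLayer K) (hF : baseField H ≤ E.1) (hS : ramificationSubgroup K S ≤ galFixing K E.1) :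
    letI := algOfLE hF
    ↥(galoisGroupAbove S H) →* (E.1 ≃ₐ[baseField H] E.1) :=
  letI := algOfLE hF
  (toAbove S H).liftOfSurjective (toAbove_surjective S H)
    ⟨galRestrict E hF, ker_toAbove_le_ker_galRestrict S E hF hS⟩

/-- `layerHom (σ N_S) = σ|_E`. [cite: NeukirchSchmidtWingberg2008, VIII §3] -/
theorem layerHom_toAbove (E : GalLayer K) (hF : baseField H ≤ E.1)
    (hS : ramificationSubgroup K S ≤ galFixing K E.1) (σ : H) :
    letI := algOfLE hF
    layerHom S E hF hS (toAbove S H σ) = galRestrict E hF σ :=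
  (toAbove S H).liftOfRightInverse_comp_apply _ _ _ σ

/-- `layerHom` is onto when `H` is closed. [cite: NeukirchANT1999, Ch. IV (1.2)] -/
theorem layerHom_surjective [NumberField K] (hH : IsClosed (H : Set (absoluteGaloisGroup K))) (E : GalLayer K)
    (hF : baseField H ≤ E.1) (hS : ramificationSubgroup K S ≤ galFixing K E.1) :
    letI := algOfLE hF
    Function.Surjective (layerHom S E hF hS) := by
  letI := algOfLE hF
  intro τ
  obtain ⟨σ, hσ⟩ := galRestrict_surjective hH E hF τ
  exact ⟨toAbove S H σ, (layerHom_toAbove S E hF hS σ).trans hσ⟩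

/-- Membership in the kernel of `layerHom`, for classes of elements of `H`: `σ ∈ Gal(K̄/E)`.
[cite: NeukirchSchmidtWingberg2008, VIII §3] -/
theorem toAbove_mem_ker_layerHom_iff (E : GalLayer K) (hF : baseField H ≤ E.1)
    (hS : ramificationSubgroup K S ≤ galFixing K E.1) (σ : H) :
    letI := algOfLE hF
    toAbove S H σ ∈ (layerHom S E hF hS).ker ↔ (σ : absoluteGaloisGroup K) ∈ galFixing K E.1 := by
  letI := algOfLE hF
  rw [MonoidHom.mem_ker, layerHom_toAbove, ← MonoidHom.mem_ker]
  exact mem_ker_galRestrict_iff E hF σ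

/-- The kernel of `layerHom` is OPEN in `U`: it contains the image of the open subgroup `Gal(K̄/E) ⊓ H` of the open
subgroup `H`, and `Γ_K → G_{K,S}` is an open map. [cite: SerreGaloisCohomology1997, I §2.2 Prop. 8] -/
theorem isOpen_ker_layerHom [NumberField K] (hHo : IsOpen (H : Set (absoluteGaloisGroup K))) (E : GalLayer K)
    (hF : baseField H ≤ E.1) (hS : ramificationSubgroup K S ≤ galFixing K E.1) :
    letI := algOfLE hF
    IsOpen (((layerHom S E hF hS).ker : Subgroup ↥(galoisGroupAbove S H)) : Set ↥(galoisGroupAbove S H)) := by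
  letI := algOfLE hF
  haveI := E.finiteDimensional
  -- the subgroup `(Gal(K̄/E) ⊓ H).map toAbove ≤ ker`
  let V : Subgroup H := (galFixing K E.1).subgroupOf H
  have hVle : V.map (toAbove S H) ≤ (layerHom S E hF hS).ker := by
    rintro _ ⟨σ, hσ, rfl⟩
    exact (toAbove_mem_ker_layerHom_iff S E hF hS σ).2 hσ
  refine Subgroup.isOpen_mono hVle ?_
  -- `toAbove '' V` is the trace on `U` of the open set `mk '' (Gal(K̄/E) ∩ H)`
  have hO : IsOpen (toUnramifiedQuot K S '' ((galFixing K E.1 : Set (absoluteGaloisGroup K)) ∩ H)) :=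
    isOpenMap_toUnramifiedQuot K S _ ((isOpen_galFixing K E.1).inter hHo)
  have heq : ((V.map (toAbove S H) : Subgroup ↥(galoisGroupAbove S H)) : Set ↥(galoisGroupAbove S H)) =
      Subtype.val ⁻¹' (toUnramifiedQuot K S '' ((galFixing K E.1 : Set (absoluteGaloisGroup K)) ∩ H)) := by
    ext u
    constructor
    · rintro ⟨σ, hσ, rfl⟩
      exact ⟨σ, ⟨hσ, σ.2⟩, rfl⟩
    · rintro ⟨σ, ⟨hσV, hσH⟩, hσu⟩
      exact ⟨⟨σ, hσH⟩, hσV, Subtype.ext hσu⟩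
  rw [heq]
  exact hO.preimage continuous_subtype_val

/-- **The layer subgroup `Gal(K_S/E) ≤ U` as an open normal subgroup** (the kernel of `layerHom`).
[cite: SerreGaloisCohomology1997, I §2.2 Prop. 8] [cite: NeukirchSchmidtWingberg2008, VIII §3] -/
def layerSubgroup [NumberField K] (hHo : IsOpen (H : Set (absoluteGaloisGroup K))) (E : GalLayer K)
    (hF : baseField H ≤ E.1) (hS : ramificationSubgroup K S ≤ galFixing K E.1) :
    OpenNormalSubgroup ↥(galoisGroupAbove S H) :=
  letI := algOfLE hF
  { toSubgroup := (layerHom S E hF hS).ker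
    isOpen' := isOpen_ker_layerHom S hHo E hF hS
    isNormal' := MonoidHom.normal_ker _ }

/-- The layer subgroup is the kernel of `layerHom`. [cite: NeukirchSchmidtWingberg2008, VIII §3] -/
theorem coe_layerSubgroup [NumberField K] (hHo : IsOpen (H : Set (absoluteGaloisGroup K))) (E : GalLayer K)
    (hF : baseField H ≤ E.1) (hS : ramificationSubgroup K S ≤ galFixing K E.1) :
    letI := algOfLE hF
    ((layerSubgroup S hHo E hF hS : OpenNormalSubgroup ↥(galoisGroupAbove S H)) : Subgroup ↥(galoisGroupAbove S H)) =
      (layerHom S E hF hS).ker := rfl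

/-- Membership: `σ N_S ∈ layerSubgroup E ↔ σ ∈ Gal(K̄/E)`. [cite: NeukirchSchmidtWingberg2008, VIII §3] -/
theorem toAbove_mem_layerSubgroup_iff [NumberField K] (hHo : IsOpen (H : Set (absoluteGaloisGroup K)))
    (E : GalLayer K) (hF : baseField H ≤ E.1) (hS : ramificationSubgroup K S ≤ galFixing K E.1) (σ : H) :
    toAbove S H σ ∈ layerSubgroup S hHo E hF hS ↔ (σ : absoluteGaloisGroup K) ∈ galFixing K E.1 :=
  toAbove_mem_ker_layerHom_iff S E hF hS σ

/-- **`U ⧸ Gal(K_S/E) ≃* Gal(E/F₀)`** (first isomorphism theorem for the surjection `layerHom`; `H` open is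
closed). [cite: NeukirchSchmidtWingberg2008, VIII §3] [cite: SerreGaloisCohomology1997, I §2.2 Prop. 8] -/
def layerEquiv [NumberField K] (hHo : IsOpen (H : Set (absoluteGaloisGroup K))) (E : GalLayer K)
    (hF : baseField H ≤ E.1) (hS : ramificationSubgroup K S ≤ galFixing K E.1) :
    letI := algOfLE hF
    ↥(galoisGroupAbove S H) ⧸ ((layerSubgroup S hHo E hF hS : OpenNormalSubgroup ↥(galoisGroupAbove S H)) :
        Subgroup ↥(galoisGroupAbove S H)) ≃* (E.1 ≃ₐ[baseField H] E.1) :=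
  letI := algOfLE hF
  QuotientGroup.quotientKerEquivOfSurjective (layerHom S E hF hS)
    (layerHom_surjective S (Subgroup.isClosed_of_isOpen H hHo) E hF hS)

/-- Formula: `layerEquiv [u] = layerHom u`. [cite: NeukirchSchmidtWingberg2008, VIII §3] -/
theorem layerEquiv_mk [NumberField K] (hHo : IsOpen (H : Set (absoluteGaloisGroup K))) (E : GalLayer K)
    (hF : baseField H ≤ E.1) (hS : ramificationSubgroup K S ≤ galFixing K E.1) (u : ↥(galoisGroupAbove S H)) :
    letI := algOfLE hF
    layerEquiv S hHo E hF hS (QuotientGroup.mk u) = layerHom S E hF hS u := rfl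

/-- Formula on `K̄`-values: `layerEquiv [σ N_S] x = σ • x`. [cite: NeukirchSchmidtWingberg2008, VIII §3] -/
theorem coe_layerEquiv_mk_toAbove [NumberField K] (hHo : IsOpen (H : Set (absoluteGaloisGroup K)))
    (E : GalLayer K) (hF : baseField H ≤ E.1) (hS : ramificationSubgroup K S ≤ galFixing K E.1)
    (σ : H) (x : E.1) :
    letI := algOfLE hF
    ((layerEquiv S hHo E hF hS (QuotientGroup.mk (toAbove S H σ)) x : E.1) : AlgebraicClosure K) =
      (σ : absoluteGaloisGroup K) • (x : AlgebraicClosure K) := by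
  letI := algOfLE hF
  have h1 : layerEquiv S hHo E hF hS (QuotientGroup.mk (toAbove S H σ)) = galRestrict E hF σ :=
    (layerEquiv_mk S hHo E hF hS _).trans (layerHom_toAbove S E hF hS σ)
  rw [h1]
  exact coe_galRestrict_apply E hF σ x

/-- Formula on `K̄`-values for an arbitrary `u ∈ U` and any lift `σ ∈ H`: `layerEquiv [u] x = σ • x`.
[cite: NeukirchSchmidtWingberg2008, VIII §3] -/
theorem coe_layerEquiv_mk_of_toAbove_eq [NumberField K] (hHo : IsOpen (H : Set (absoluteGaloisGroup K)))
    (E : GalLayer K) (hF : baseField H ≤ E.1) (hS : ramificationSubgroup K S ≤ galFixing K E.1)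
    {u : ↥(galoisGroupAbove S H)} {σ : H} (hσ : toAbove S H σ = u) (x : E.1) :
    letI := algOfLE hF
    ((layerEquiv S hHo E hF hS (QuotientGroup.mk u) x : E.1) : AlgebraicClosure K) =
      (σ : absoluteGaloisGroup K) • (x : AlgebraicClosure K) := by
  subst hσ
  exact coe_layerEquiv_mk_toAbove S hHo E hF hS σ x

/-! ### §4. Cofinality -/

/-- **Every open normal subgroup `W ≤ U` contains a layer subgroup `Gal(K_S/E)`** with `E/K` finite Galois,
`F₀ ≤ E ⊆ K_S`: the preimage of `W` in `Γ_K` contains `N_S` and an open normal `N` (`Γ_K` is profinite), and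
`E := K̄^{N·N_S}` works (`N·N_S ≤ H` is open normal, contains `N_S`, and `Gal(K̄/K̄^{N·N_S}) = N·N_S`).
[cite: SerreGaloisCohomology1997, I §2.2 Prop. 8] [cite: NeukirchSchmidtWingberg2008, (1.5.1)] -/
theorem exists_layerSubgroup_le [NumberField K] (hHo : IsOpen (H : Set (absoluteGaloisGroup K)))
    (hNH : ramificationSubgroup K S ≤ H) (W : OpenNormalSubgroup ↥(galoisGroupAbove S H)) :
    ∃ (E : GalLayer K) (hF : baseField H ≤ E.1) (hS : ramificationSubgroup K S ≤ galFixing K E.1),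
      ((layerSubgroup S hHo E hF hS : OpenNormalSubgroup ↥(galoisGroupAbove S H)) :
          Subgroup ↥(galoisGroupAbove S H)) ≤ W := by
  -- the preimage `W₀` of `W` in `H ≤ Γ_K` is open; pick an open normal `Gal(K̄/E₁) ≤ Γ_K` inside it
  let W₀ : Subgroup (absoluteGaloisGroup K) := ((W : Subgroup _).comap (toAbove S H)).map H.subtype
  have hW₀o : IsOpen (W₀ : Set (absoluteGaloisGroup K)) := by
    have h1 : IsOpen (((W : Subgroup _).comap (toAbove S H) : Subgroup H) : Set H) :=
      W.isOpen'.preimage (continuous_toAbove S H)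
    exact hHo.isOpenEmbedding_subtypeVal.isOpenMap _ h1
  obtain ⟨E₁, hE₁fin, hE₁gal, hE₁W⟩ := exists_finiteDimensional_isGalois_galFixing_subset (k := K)
    (hW₀o.mem_nhds W₀.one_mem)
  haveI := hE₁fin
  haveI := hE₁gal
  -- `N := Gal(K̄/E₁) ⊔ N_S`, an open normal subgroup of `Γ_K` inside `H` containing `N_S`
  let N : Subgroup (absoluteGaloisGroup K) := galFixing K E₁ ⊔ ramificationSubgroup K S
  haveI : (galFixing K E₁).Normal := by
    rw [← ker_resGal]
    exact MonoidHom.normal_ker _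
  haveI hNn : N.Normal := Subgroup.sup_normal _ _
  have hNo : IsOpen (N : Set (absoluteGaloisGroup K)) :=
    Subgroup.isOpen_mono le_sup_left (isOpen_galFixing K E₁)
  have hW₀H : W₀ ≤ H := by
    rintro _ ⟨σ, -, rfl⟩
    exact σ.2
  have hNSW₀ : ramificationSubgroup K S ≤ W₀ := fun σ hσ => by
    refine ⟨⟨σ, hNH hσ⟩, ?_, rfl⟩
    change toAbove S H ⟨σ, hNH hσ⟩ ∈ (W : Subgroup _)
    have h1 : toAbove S H ⟨σ, hNH hσ⟩ = 1 := (mem_ker_toAbove_iff S H _).2 hσ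
    simpa only [h1] using (W : Subgroup ↥(galoisGroupAbove S H)).one_mem
  have hNW₀ : N ≤ W₀ := sup_le (fun σ hσ => hE₁W hσ) hNSW₀
  have hNH' : N ≤ H := hNW₀.trans hW₀H
  -- the layer `E := K̄^N`
  let Nons : OpenNormalSubgroup (absoluteGaloisGroup K) := ⟨⟨N, hNo⟩, hNn⟩
  let E : GalLayer K := IdeleClassBar.GalLayer.ofOpenNormalSubgroup Nons
  have hEfix : galFixing K E.1 = N := by
    have h := IdeleClassBar.GalLayer.openNormalSubgroup_ofOpenNormalSubgroup Nons
    have h' : ((IdeleClassBar.GalLayer.ofOpenNormalSubgroup Nons).openNormalSubgroup :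
        Subgroup (absoluteGaloisGroup K)) = N := by rw [h]
    exact h'
  have hF : baseField H ≤ E.1 := by
    intro x hx
    change x ∈ IntermediateField.fixedField (N : Subgroup (AlgebraicClosure K ≃ₐ[K] AlgebraicClosure K))
    rw [IntermediateField.mem_fixedField_iff]
    intro σ hσ
    exact (IntermediateField.mem_fixedField_iff _ x).1 hx σ (hNH' hσ)
  have hS : ramificationSubgroup K S ≤ galFixing K E.1 := by
    rw [hEfix]
    exact le_sup_right
  refine ⟨E, hF, hS, fun u hu => ?_⟩
  obtain ⟨σ, rfl⟩ := toAbove_surjective S H u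
  have hσN : (σ : absoluteGaloisGroup K) ∈ N := by
    rw [← hEfix]
    exact (toAbove_mem_layerSubgroup_iff S hHo E hF hS σ).1 hu
  obtain ⟨τ, hτ, hτσ⟩ := hNW₀ hσN
  have : τ = σ := Subtype.ext hτσ
  rw [← this]
  exact hτ

/-! ### §5. Transitions between two layers `E ≤ E′` -/

/-- `N_S ≤ Gal(K̄/E′) ≤ Gal(K̄/E)` for `E ≤ E′`. [cite: NeukirchANT1999, Ch. IV §1] -/
theorem ramificationSubgroup_le_galFixing_of_le {E E' : GalLayer K} (hEE' : E ≤ E')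
    (hS' : ramificationSubgroup K S ≤ galFixing K E'.1) : ramificationSubgroup K S ≤ galFixing K E.1 :=
  hS'.trans (galFixing_antitone K hEE')

/-- **`layerSubgroup E′ ≤ layerSubgroup E` for `E ≤ E′`.** [cite: SerreGaloisCohomology1997, I §2.2 Prop. 8] -/
theorem layerSubgroup_anti [NumberField K] (hHo : IsOpen (H : Set (absoluteGaloisGroup K))) {E E' : GalLayer K}
    (hEE' : E ≤ E') (hF : baseField H ≤ E.1) (hS' : ramificationSubgroup K S ≤ galFixing K E'.1) :
    ((layerSubgroup S hHo E' (hF.trans hEE') hS' : OpenNormalSubgroup ↥(galoisGroupAbove S H)) :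
        Subgroup ↥(galoisGroupAbove S H)) ≤
      layerSubgroup S hHo E hF (ramificationSubgroup_le_galFixing_of_le S hEE' hS') := by
  intro u hu
  obtain ⟨σ, rfl⟩ := toAbove_surjective S H u
  exact (toAbove_mem_layerSubgroup_iff S hHo E hF _ σ).2
    (galFixing_antitone K hEE' ((toAbove_mem_layerSubgroup_iff S hHo E' (hF.trans hEE') hS' σ).1 hu))

/-- **Compatibility of the layer isomorphisms with the transitions, on values**: for `E ≤ E′`, `u ∈ U` and
`x ∈ E`, `layerEquiv E [u] x` and `layerEquiv E′ [u] x` agree in `K̄` (both are `σ • x` for a lift `σ ∈ H` of `u`;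
the `restrictNormalHom` form follows in the consumer's algebra context).
[cite: SerreGaloisCohomology1997, I §2.2 Prop. 8] -/
theorem coe_layerEquiv_mk_eq_of_le [NumberField K] (hHo : IsOpen (H : Set (absoluteGaloisGroup K)))
    {E E' : GalLayer K} (hEE' : E ≤ E') (hF : baseField H ≤ E.1)
    (hS' : ramificationSubgroup K S ≤ galFixing K E'.1) (u : ↥(galoisGroupAbove S H)) (x : E.1) :
    letI := algOfLE hF
    letI := algOfLE (hF.trans hEE')
    ((layerEquiv S hHo E hF (ramificationSubgroup_le_galFixing_of_le S hEE' hS') (QuotientGroup.mk u) x : E.1) :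
        AlgebraicClosure K) =
      ((layerEquiv S hHo E' (hF.trans hEE') hS' (QuotientGroup.mk u) ⟨(x : AlgebraicClosure K), hEE' x.2⟩ : E'.1) :
        AlgebraicClosure K) := by
  obtain ⟨σ, rfl⟩ := toAbove_surjective S H u
  rw [coe_layerEquiv_mk_toAbove, coe_layerEquiv_mk_toAbove]

end OpenSubgroupLayer

end Literature.NumberTheory.GaloisRepresentations

end
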